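import Mathlib

/-!
# PercRepro — ONE CO-HYPERPLANE OF ANY SIZE, PART 2: THE EXACT SOLUTION OF THE RECURSION AND ITS BOUNDS (p10, gen 33)

Pure binomial arithmetic for the radial weights of PuncturedLYMCoHyp.  Parameters `n` (points), `j` (level), `m = #C`
with `1 ≤ m ≤ j` and `2j + 1 ≤ n`; `r = n − j`, `h = n − m`, `#P = C(n, j) − C(h, j − m)`.
In deviation form the weights are `xv c = (k/(j+1))·(1 − ξ_c)`, `yv c = (k/(j+1))·(1 + η_c)` with `k = #P/C(n, j+1)`,
`η_c = ((r − m + c)·ξ_c + Δ)/(m − c)`, `Δ = r·C(h, j − m)/#P`, and the row / column identities of part 1 hold iff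
`ξ_0 = 0` and `ξ_{c+1} = (c + 1)·((r − m + c)·ξ_c + Δ)/((m − c)(j − c))` (`coXi_succ`).  THE EXACT SOLUTION:

    ξ_c = V_c · Q_c / (C(m, c) · #P),   V_c = Σ_{k<c} C(m,k)·C(h, j−k),   Q_c = Π_{i<m−c} (j−m+1+i)/(r−m+c+i),

(`coXi`), whose recursion follows from `V_{c+1} = V_c + C(m,c)C(h,j−c)`, `Q_c = Q_{c+1}·(j−c)/(r−m+c)` and the
constancy `(r − m + c)·C(h, j − c)·Q_c = r·C(h, j − m)` (`coQ_key`, downward induction from `Q_m = 1`).  BOUNDS: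
`0 ≤ V_c ≤ V_m = #P` (Vandermonde, `coV_le_coP`), `0 ≤ Q_c ≤ 1` (every factor `≤ 1` iff `2j + 1 ≤ n + c`,
`coQ_le_one`), hence `0 ≤ ξ_c ≤ 1` and `η_c ≥ 0` — every weight is nonnegative.  The top column identity
`m·yv (m − 1) = k` is `(r − 1)·ξ_{m−1} + Δ = (j + 1 − m)/m` (`coTop`), from the exact solution at `c = m − 1`.
The sequences `xv`, `yv` themselves and the five identities of part 1 are PuncturedLYMCoHypSeq2.  Nothing here
asserts (SP).
-/

namespace PercRepro.PuncturedLYM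

open Finset

/-! ### The products and sums -/

/-- `Π_{k<m−c} (j − m + 1 + k)`. -/
def coNum (j m c : ℕ) : ℚ := ∏ k ∈ range (m - c), ((j - m + 1 + k : ℕ) : ℚ)

/-- `Π_{k<m−c} (n − j − m + c + k)`. -/
def coDen (n j m c : ℕ) : ℚ := ∏ k ∈ range (m - c), ((n - j - m + c + k : ℕ) : ℚ)

/-- `Q_c = Π_{k<m−c} (j − m + 1 + k)/(n − j − m + c + k)`. -/
def coQ (n j m c : ℕ) : ℚ := coNum j m c / coDen n j m c

/-- `V_c = Σ_{k<c} C(m, k)·C(n − m, j − k)`. -/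
def coV (n j m c : ℕ) : ℚ := ∑ k ∈ range c, ((m.choose k * (n - m).choose (j - k) : ℕ) : ℚ)

/-- `#P = C(n, j) − C(n − m, j − m)`. -/
def coP (n j m : ℕ) : ℚ := (n.choose j : ℚ) - ((n - m).choose (j - m) : ℕ)

/-- `Δ = (n − j)·C(n − m, j − m)/#P`. -/
def coDelta (n j m : ℕ) : ℚ := ((n - j : ℕ) : ℚ) * ((n - m).choose (j - m) : ℕ) / coP n j m

/-- `ξ_c = V_c·Q_c/(C(m, c)·#P)`. -/
def coXi (n j m c : ℕ) : ℚ := coV n j m c * coQ n j m c / ((m.choose c : ℕ) * coP n j m)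

/-- `η_c = ((n − j − m + c)·ξ_c + Δ)/(m − c)`. -/
def coEta (n j m c : ℕ) : ℚ :=
  (((n - j - m + c : ℕ) : ℚ) * coXi n j m c + coDelta n j m) / ((m - c : ℕ) : ℚ)

/-! ### Elementary facts -/

/-- `N_m = 1` (empty product). -/
theorem coNum_top (j m : ℕ) : coNum j m m = 1 := by
  simp [coNum]

/-- `D_m = 1` (empty product). -/
theorem coDen_top (n j m : ℕ) : coDen n j m m = 1 := by
  simp [coDen]

/-- `Q_m = 1`. -/
theorem coQ_top (n j m : ℕ) : coQ n j m m = 1 := by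
  simp [coQ, coNum_top, coDen_top]

/-- `N_c = N_{c+1}·(j − c)` for `c < m ≤ j`. -/
theorem coNum_succ {j m c : ℕ} (hmj : m ≤ j) (hc : c < m) :
    coNum j m c = coNum j m (c + 1) * ((j - c : ℕ) : ℚ) := by
  unfold coNum
  have h : m - c = (m - (c + 1)) + 1 := by omega
  rw [h, prod_range_succ]
  congr 2
  omega

/-- `D_c = (n − j − m + c)·D_{c+1}` for `c < m`. -/
theorem coDen_succ {n j m c : ℕ} (hc : c < m) :
    coDen n j m c = ((n - j - m + c : ℕ) : ℚ) * coDen n j m (c + 1) := by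
  unfold coDen
  have h : m - c = (m - (c + 1)) + 1 := by omega
  rw [h, prod_range_succ', mul_comm]
  have e0 : ((n - j - m + c + 0 : ℕ) : ℚ) = ((n - j - m + c : ℕ) : ℚ) := by simp
  rw [e0]
  congr 1
  apply prod_congr rfl
  intro k _
  congr 1
  omega

/-- `D_c > 0`: every factor is at least `1` when `m ≤ j` and `2j + 1 ≤ n`. -/
theorem coDen_pos {n j m c : ℕ} (hmj : m ≤ j) (hn : 2 * j + 1 ≤ n) : 0 < coDen n j m c := by
  unfold coDen
  apply prod_pos
  intro k _
  have : 1 ≤ n - j - m + c + k := by omega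
  exact_mod_cast this

/-- `N_c ≥ 0`. -/
theorem coNum_nonneg (j m c : ℕ) : 0 ≤ coNum j m c := by
  unfold coNum
  apply prod_nonneg
  intro k _
  exact_mod_cast Nat.zero_le _

/-- `Q_c ≥ 0`. -/
theorem coQ_nonneg {n j m c : ℕ} (hmj : m ≤ j) (hn : 2 * j + 1 ≤ n) : 0 ≤ coQ n j m c :=
  div_nonneg (coNum_nonneg j m c) (coDen_pos hmj hn).le

/-- `Q_c ≤ 1`: every factor `(j − m + 1 + k)/(n − j − m + c + k)` is at most `1` when `2j + 1 ≤ n`. -/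
theorem coQ_le_one {n j m c : ℕ} (hmj : m ≤ j) (hn : 2 * j + 1 ≤ n) : coQ n j m c ≤ 1 := by
  unfold coQ coNum coDen
  rw [← prod_div_distrib]
  apply prod_le_one
  · intro k _
    apply div_nonneg
    · exact_mod_cast Nat.zero_le _
    · exact_mod_cast Nat.zero_le _
  · intro k _
    have hpos : (0 : ℚ) < ((n - j - m + c + k : ℕ) : ℚ) := by
      have : 1 ≤ n - j - m + c + k := by omega
      exact_mod_cast this
    rw [div_le_one hpos]
    have : j - m + 1 + k ≤ n - j - m + c + k := by omega
    exact_mod_cast this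

/-- `Q_c = Q_{c+1}·(j − c)/(n − j − m + c)` for `c < m`. -/
theorem coQ_succ {n j m c : ℕ} (hmj : m ≤ j) (hn : 2 * j + 1 ≤ n) (hc : c < m) :
    coQ n j m c * ((n - j - m + c : ℕ) : ℚ) = coQ n j m (c + 1) * ((j - c : ℕ) : ℚ) := by
  unfold coQ
  rw [coNum_succ hmj hc, coDen_succ hc]
  have h1 : (0 : ℚ) < ((n - j - m + c : ℕ) : ℚ) := by
    have : 1 ≤ n - j - m + c := by omega
    exact_mod_cast this
  have h2 := coDen_pos (n := n) (j := j) (m := m) (c := c + 1) hmj hn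
  field_simp

/-! ### The partial Vandermonde sums -/

/-- `V_0 = 0`. -/
theorem coV_zero (n j m : ℕ) : coV n j m 0 = 0 := by
  simp [coV]

/-- `V_{c+1} = V_c + C(m, c)·C(n − m, j − c)`. -/
theorem coV_succ (n j m c : ℕ) :
    coV n j m (c + 1) = coV n j m c + ((m.choose c * (n - m).choose (j - c) : ℕ) : ℚ) := by
  unfold coV
  rw [sum_range_succ]

/-- `V_c ≥ 0`. -/
theorem coV_nonneg (n j m c : ℕ) : 0 ≤ coV n j m c := by
  unfold coV
  apply sum_nonneg
  intro k _
  exact_mod_cast Nat.zero_le _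

/-- `V_c ≤ V_m` for `c ≤ m` (nonnegative terms). -/
theorem coV_mono {n j m c : ℕ} (hc : c ≤ m) : coV n j m c ≤ coV n j m m := by
  unfold coV
  apply sum_le_sum_of_subset_of_nonneg (range_subset_range.2 hc)
  intro k _ _
  exact_mod_cast Nat.zero_le _

/-- Vandermonde: `Σ_{k ≤ m} C(m, k)·C(n − m, j − k) = C(n, j)` for `m ≤ j`, `m ≤ n`. -/
theorem vandermonde_range {n j m : ℕ} (hmj : m ≤ j) (hmn : m ≤ n) :
    ∑ k ∈ range (m + 1), (m.choose k * (n - m).choose (j - k) : ℕ) = n.choose j := by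
  have h := Nat.add_choose_eq m (n - m) j
  rw [Nat.add_sub_cancel' hmn, Finset.Nat.sum_antidiagonal_eq_sum_range_succ_mk] at h
  rw [h]
  symm
  rw [← sum_range_add_sum_Ico _ (Nat.succ_le_succ hmj)]
  have h0 : ∑ k ∈ Ico (m + 1) (j + 1), (m.choose k * (n - m).choose (j - k) : ℕ) = 0 := by
    apply sum_eq_zero
    intro k hk
    rw [mem_Ico] at hk
    rw [Nat.choose_eq_zero_of_lt (by omega), zero_mul]
  rw [h0, add_zero]

/-- `V_m = #P`. -/
theorem coV_top {n j m : ℕ} (hmj : m ≤ j) (hmn : m ≤ n) : coV n j m m = coP n j m := by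
  unfold coV coP
  have h := vandermonde_range (n := n) hmj hmn
  rw [sum_range_succ, Nat.choose_self, one_mul] at h
  have h' : ((∑ k ∈ range m, (m.choose k * (n - m).choose (j - k) : ℕ) : ℕ) : ℚ) +
      ((n - m).choose (j - m) : ℕ) = (n.choose j : ℚ) := by exact_mod_cast h
  rw [Nat.cast_sum] at h'
  linarith

/-- `V_c ≤ #P` for `c ≤ m`. -/
theorem coV_le_coP {n j m c : ℕ} (hmj : m ≤ j) (hmn : m ≤ n) (hc : c ≤ m) : coV n j m c ≤ coP n j m := by
  rw [← coV_top hmj hmn]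
  exact coV_mono hc

/-- `#P > 0` (`1 ≤ m ≤ j`, `2j + 1 ≤ n`): the term `k = 0` of `V_m` is `C(n − m, j) ≥ 1`. -/
theorem coP_pos {n j m : ℕ} (hm : 1 ≤ m) (hmj : m ≤ j) (hn : 2 * j + 1 ≤ n) : 0 < coP n j m := by
  rw [← coV_top hmj (by omega)]
  unfold coV
  have hm' : m = (m - 1) + 1 := by omega
  rw [hm', sum_range_succ', Nat.choose_zero_right, one_mul, Nat.sub_zero, ← hm']
  have hpos : 0 < (n - m).choose j := Nat.choose_pos (by omega)
  have : (0 : ℚ) < ((n - m).choose j : ℕ) := by exact_mod_cast hpos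
  have hnn : 0 ≤ ∑ k ∈ range (m - 1), ((m.choose (k + 1) * (n - m).choose (j - (k + 1)) : ℕ) : ℚ) := by
    apply sum_nonneg
    intro k _
    exact_mod_cast Nat.zero_le _
  linarith

/-- `Δ ≥ 0`. -/
theorem coDelta_nonneg {n j m : ℕ} (hm : 1 ≤ m) (hmj : m ≤ j) (hn : 2 * j + 1 ≤ n) : 0 ≤ coDelta n j m := by
  unfold coDelta
  apply div_nonneg _ (coP_pos hm hmj hn).le
  apply mul_nonneg
  · exact_mod_cast Nat.zero_le _
  · exact_mod_cast Nat.zero_le _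

/-! ### The key constancy -/

/-- `(n − j − m + c)·C(n − m, j − c)·Q_c = (n − j)·C(n − m, j − m)` for every `c ≤ m` (downward induction). -/
theorem coQ_key {n j m : ℕ} (hmj : m ≤ j) (hn : 2 * j + 1 ≤ n) :
    ∀ c, c ≤ m →
      ((n - j - m + c : ℕ) : ℚ) * ((n - m).choose (j - c) : ℕ) * coQ n j m c =
        ((n - j : ℕ) : ℚ) * ((n - m).choose (j - m) : ℕ) := by
  intro c hc
  induction' hd : m - c with d ih generalizing c
  · have : c = m := by omega
    subst this
    rw [coQ_top, mul_one]
    congr 2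
    omega
  · -- from `c + 1` to `c`
    have hc1 : c + 1 ≤ m := by omega
    have hih := ih (c + 1) hc1 (by omega)
    have hq := coQ_succ (n := n) (j := j) (m := m) (c := c) hmj hn (by omega)
    -- `C(h, j − c)·(j − c) = C(h, j − c − 1)·(h − (j − c − 1))`, `h − (j − c − 1) = n − j − m + c + 1`
    have hch := Nat.choose_succ_right_eq (n - m) (j - (c + 1))
    have e1 : j - (c + 1) + 1 = j - c := by omega
    have e2 : n - m - (j - (c + 1)) = n - j - m + (c + 1) := by omega
    rw [e1, e2] at hch
    have hchq : ((n - m).choose (j - c) : ℚ) * ((j - c : ℕ) : ℚ) =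
        ((n - m).choose (j - (c + 1)) : ℚ) * ((n - j - m + (c + 1) : ℕ) : ℚ) := by exact_mod_cast hch
    calc ((n - j - m + c : ℕ) : ℚ) * ((n - m).choose (j - c) : ℕ) * coQ n j m c
        = ((n - m).choose (j - c) : ℕ) * (coQ n j m c * ((n - j - m + c : ℕ) : ℚ)) := by ring
      _ = ((n - m).choose (j - c) : ℕ) * (coQ n j m (c + 1) * ((j - c : ℕ) : ℚ)) := by rw [hq]
      _ = (((n - m).choose (j - c) : ℚ) * ((j - c : ℕ) : ℚ)) * coQ n j m (c + 1) := by ring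
      _ = (((n - m).choose (j - (c + 1)) : ℚ) * ((n - j - m + (c + 1) : ℕ) : ℚ)) * coQ n j m (c + 1) := by
          rw [hchq]
      _ = ((n - j - m + (c + 1) : ℕ) : ℚ) * ((n - m).choose (j - (c + 1)) : ℕ) * coQ n j m (c + 1) := by ring
      _ = ((n - j : ℕ) : ℚ) * ((n - m).choose (j - m) : ℕ) := hih

/-! ### The exact solution: the recursion and the bounds -/

/-- `ξ_0 = 0`. -/
theorem coXi_zero (n j m : ℕ) : coXi n j m 0 = 0 := by
  simp [coXi, coV_zero]

/-- **The recursion** `ξ_{c+1} = (c+1)·((n − j − m + c)·ξ_c + Δ)/((m − c)(j − c))` for `c < m`. -/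
theorem coXi_succ {n j m c : ℕ} (hm : 1 ≤ m) (hmj : m ≤ j) (hn : 2 * j + 1 ≤ n) (hc : c < m) :
    coXi n j m (c + 1) =
      ((c : ℚ) + 1) * (((n - j - m + c : ℕ) : ℚ) * coXi n j m c + coDelta n j m) /
        (((m - c : ℕ) : ℚ) * ((j - c : ℕ) : ℚ)) := by
  have hP := coP_pos hm hmj hn
  have hB : (0 : ℚ) < (m.choose c : ℕ) := by exact_mod_cast Nat.choose_pos hc.le
  have hB1 : (0 : ℚ) < (m.choose (c + 1) : ℕ) := by exact_mod_cast Nat.choose_pos hc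
  have hmc : (0 : ℚ) < ((m - c : ℕ) : ℚ) := by
    have : 1 ≤ m - c := by omega
    exact_mod_cast this
  have hjc : (0 : ℚ) < ((j - c : ℕ) : ℚ) := by
    have : 1 ≤ j - c := by omega
    exact_mod_cast this
  have hrc : (0 : ℚ) < ((n - j - m + c : ℕ) : ℚ) := by
    have : 1 ≤ n - j - m + c := by omega
    exact_mod_cast this
  -- `C(m, c+1)·(c+1) = C(m, c)·(m − c)`
  have hch := Nat.choose_succ_right_eq m c
  have hchq : ((m.choose (c + 1) : ℕ) : ℚ) * ((c : ℚ) + 1) = ((m.choose c : ℕ) : ℚ) * ((m - c : ℕ) : ℚ) := by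
    have : (((m.choose (c + 1) * (c + 1) : ℕ) : ℕ) : ℚ) = ((m.choose c * (m - c) : ℕ) : ℚ) := by rw [hch]
    push_cast at this
    linarith
  have hq := coQ_succ (n := n) (j := j) (m := m) (c := c) hmj hn hc
  have hkey := coQ_key (n := n) (j := j) (m := m) hmj hn c hc.le
  -- express `Δ` through the key identity at `c`
  have hΔ : coDelta n j m =
      ((n - j - m + c : ℕ) : ℚ) * ((n - m).choose (j - c) : ℕ) * coQ n j m c / coP n j m := by
    unfold coDelta
    rw [hkey]
  have e1 : coQ n j m (c + 1) = coQ n j m c * ((n - j - m + c : ℕ) : ℚ) / ((j - c : ℕ) : ℚ) := by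
    rw [hq]
    field_simp
  have e2 : ((m.choose (c + 1) : ℕ) : ℚ) = ((m.choose c : ℕ) : ℚ) * ((m - c : ℕ) : ℚ) / ((c : ℚ) + 1) := by
    rw [eq_div_iff (by positivity)]
    exact hchq
  unfold coXi
  rw [coV_succ, e1, e2, hΔ]
  push_cast
  field_simp

/-- `ξ_c ≥ 0`. -/
theorem coXi_nonneg {n j m c : ℕ} (hm : 1 ≤ m) (hmj : m ≤ j) (hn : 2 * j + 1 ≤ n) : 0 ≤ coXi n j m c := by
  unfold coXi
  apply div_nonneg
  · exact mul_nonneg (coV_nonneg n j m c) (coQ_nonneg hmj hn)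
  · apply mul_nonneg
    · exact_mod_cast Nat.zero_le _
    · exact (coP_pos hm hmj hn).le

/-- **`ξ_c ≤ 1`** for `c ≤ m`: `V_c ≤ #P`, `Q_c ≤ 1`, `C(m, c) ≥ 1`. -/
theorem coXi_le_one {n j m c : ℕ} (hm : 1 ≤ m) (hmj : m ≤ j) (hn : 2 * j + 1 ≤ n) (hc : c ≤ m) :
    coXi n j m c ≤ 1 := by
  unfold coXi
  have hP := coP_pos hm hmj hn
  have hB : (1 : ℚ) ≤ (m.choose c : ℕ) := by exact_mod_cast Nat.choose_pos hc
  rw [div_le_one (by positivity)]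
  calc coV n j m c * coQ n j m c ≤ coP n j m * 1 :=
        mul_le_mul (coV_le_coP hmj (by omega) hc) (coQ_le_one hmj hn) (coQ_nonneg hmj hn) hP.le
    _ = 1 * coP n j m := by ring
    _ ≤ (m.choose c : ℕ) * coP n j m := mul_le_mul_of_nonneg_right hB hP.le

/-- `η_c ≥ 0`. -/
theorem coEta_nonneg {n j m c : ℕ} (hm : 1 ≤ m) (hmj : m ≤ j) (hn : 2 * j + 1 ≤ n) :
    0 ≤ coEta n j m c := by
  unfold coEta
  apply div_nonneg
  · apply add_nonneg
    · apply mul_nonneg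
      · exact_mod_cast Nat.zero_le _
      · exact coXi_nonneg hm hmj hn
    · exact coDelta_nonneg hm hmj hn
  · exact_mod_cast Nat.zero_le _

/-- **The top identity**: `(n − j − 1)·ξ_{m−1} + Δ = (j + 1 − m)/m`. -/
theorem coTop {n j m : ℕ} (hm : 1 ≤ m) (hmj : m ≤ j) (hn : 2 * j + 1 ≤ n) :
    ((n - j - 1 : ℕ) : ℚ) * coXi n j m (m - 1) + coDelta n j m = ((j + 1 - m : ℕ) : ℚ) / (m : ℚ) := by
  have hP := coP_pos hm hmj hn
  have hmq : (0 : ℚ) < (m : ℚ) := by exact_mod_cast hm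
  -- `Q_{m−1} = (j − m + 1)/(n − j − 1)`
  have hQ : coQ n j m (m - 1) = ((j - m + 1 : ℕ) : ℚ) / ((n - j - 1 : ℕ) : ℚ) := by
    unfold coQ coNum coDen
    have h1 : m - (m - 1) = 1 := by omega
    rw [h1, prod_range_one, prod_range_one]
    congr 2
    omega
  -- `V_{m−1} = #P − m·C(n − m, j − m + 1)`
  have hV : coV n j m (m - 1) = coP n j m - (m : ℚ) * ((n - m).choose (j - m + 1) : ℕ) := by
    have h := coV_succ n j m (m - 1)
    have h1 : m - 1 + 1 = m := by omega
    rw [h1, coV_top hmj (by omega)] at h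
    have h2 : m.choose (m - 1) = m := by
      rw [Nat.choose_symm (by omega), Nat.choose_one_right]
    have h3 : j - (m - 1) = j - m + 1 := by omega
    rw [h2, h3] at h
    push_cast at h
    linarith
  -- the key identity at `c = m − 1`: `(n − j − 1)·C(n − m, j − m + 1)·Q_{m−1} = (n − j)·C(n − m, j − m)`
  have hkey := coQ_key (n := n) (j := j) (m := m) hmj hn (m - 1) (by omega)
  have e1 : n - j - m + (m - 1) = n - j - 1 := by omega
  have e2 : j - (m - 1) = j - m + 1 := by omega
  rw [e1, e2] at hkey
  have hB : ((m.choose (m - 1) : ℕ) : ℚ) = (m : ℚ) := by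
    rw [Nat.choose_symm (by omega), Nat.choose_one_right]
  have hr1 : (0 : ℚ) < ((n - j - 1 : ℕ) : ℚ) := by
    have : 1 ≤ n - j - 1 := by omega
    exact_mod_cast this
  have hr1' : ((n - j - 1 : ℕ) : ℚ) ≠ 0 := hr1.ne'
  -- `Q_{m−1}·(n − j − 1) = j − m + 1`
  have hQ' : coQ n j m (m - 1) * ((n - j - 1 : ℕ) : ℚ) = ((j - m + 1 : ℕ) : ℚ) := by
    rw [hQ]
    field_simp
  -- hence `C(n − m, j − m + 1)·(j − m + 1) = (n − j)·C(n − m, j − m)`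
  have hkey' : ((n - m).choose (j - m + 1) : ℚ) * ((j - m + 1 : ℕ) : ℚ) =
      ((n - j : ℕ) : ℚ) * ((n - m).choose (j - m) : ℕ) := by
    calc ((n - m).choose (j - m + 1) : ℚ) * ((j - m + 1 : ℕ) : ℚ)
        = ((n - m).choose (j - m + 1) : ℚ) * (coQ n j m (m - 1) * ((n - j - 1 : ℕ) : ℚ)) := by rw [hQ']
      _ = ((n - j - 1 : ℕ) : ℚ) * ((n - m).choose (j - m + 1) : ℕ) * coQ n j m (m - 1) := by ring
      _ = ((n - j : ℕ) : ℚ) * ((n - m).choose (j - m) : ℕ) := hkey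
  unfold coXi coDelta
  rw [hB, hV, hQ]
  have hcast : ((j + 1 - m : ℕ) : ℚ) = ((j - m + 1 : ℕ) : ℚ) := by congr 1; omega
  rw [hcast]
  field_simp
  linear_combination (-(m : ℚ)) * hkey'

end PercRepro.PuncturedLYM
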